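import Summits.Ventures.PercRepro.RankLevelSetCoreSevenOfFormSplitKY
import Summits.Ventures.PercRepro.RankLevelSetCoreSevenOfForm
import Summits.Ventures.PercRepro.S1TriangleCountBootEightC
import Summits.Ventures.PercRepro.S1TriangleBoundEightCValuesA
import Summits.Ventures.PercRepro.RankLevelSetFiveCircuitAvg
import Summits.Ventures.PercRepro.RankLevelSetLevelSevenRowThirtySevenBigFlatCells
import Summits.Ventures.PercRepro.S1CoreFourCircuitSum
import Summits.Ventures.PercRepro.S1CoreCapEightExactFinal
import Summits.Ventures.PercRepro.S1CoreCapEightExactChain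
import Summits.Ventures.PercRepro.S1CoreCapEightExactChainB
import Summits.Ventures.PercRepro.S1FiveCircuitCountSharpC
import Summits.Ventures.PercRepro.RankLevelSetLevelSixRowsNineToFifteen
import Summits.Ventures.PercRepro.S3SixWindow
import Summits.Ventures.PercRepro.RankLevelSetLevelSevenRowThirtySevenTelForm
import Summits.Ventures.PercRepro.RankLevelSetLevelSevenRowThirtySevenTelCellsA
import Summits.Ventures.PercRepro.RankLevelSetLevelSevenRowThirtySevenLarge

/-!
# PercRepro — THE ROW `37` OF LEVEL `7` AT ITS RANK: C-025 AT `q = 7`, `p = 37`, FOR EVERY FINITE MATROID, ON THE TELESCOPING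
COUNT WITH THE NULLITY SPLIT IN `k` STEPS, THE BONFERRONI CORRECTION AT LEVEL `7` AND THE SPLIT `Y`-TAIL (THE (C3)-REFINED TRIANGLE COUNT `triBound8C` ON THE KERNELS AT NULLITIES `4` AND `5`, THE EXACT s₄ CHAIN, T4⁺, THE AVERAGING FIVE-CIRCUIT COUNT `702` AT `d = 8`, THE GIANT-FLAT CASE SPLIT AT `d = 71 … 73`) (p9, gen 29; S4 — the row `37` of the `q = 7` window; the rows `≥ 38` are chained
in RankLevelSetLevelSevenRowThirtyEightChain)

Level `7` at rank `37` by the per-rank wrapper `rls_succ_large_at 6 7 37` (p8 g0, S3SixWindow): level `6` at `36`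
(`c025_six_all`) and the `e`-free core at `(37, d)` for every `d ≥ 8` — the cells `8 ≤ d ≤ 159` by their numeric forms ON
THE TELESCOPING COUNT (`tel_form37_lo` / `tel_form37_hi`, RankLevelSetLevelSevenRowThirtySevenTelForm: the `N`-side `nsideTel 37 d S3 S4 S5` with the
disjoint pair count and the per-level minimum of the quartic pair bound and the coloop telescoping; the nullity-capped
`Y`-tail or the count-based one, THE NULLITY SPLIT IN `k` STEPS per cell, THE BONFERRONI CORRECTION AT LEVEL `7`) through `c025_core_seven_of_form_splitky` (RankLevelSetCoreSevenOfFormSplitKY) with `hs3` from THE (C3)-REFINED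
TRIANGLE COUNT `S1.ncard_triangles_le_triBound8C` (S1TriangleCountBootEightC: p8's deletion induction with the rank-4 bound used at every `m ≥ 3` from nullity `7` on — `18` at `ν = 8`), `hs5` at `d = 8` from THE AVERAGING RECURSION `ncard_fiveCircuits_le_seven_oh_two` (RankLevelSetFiveCircuitAvg, p8 g6: `s₅ ≤ 702` at nullity `8`), the cells `71 … 73` by THE GIANT-FLAT CASE SPLIT (`c025_core_seven_cell_thirty_seven_seventy_one` … `_three`, RankLevelSetLevelSevenRowThirtySevenBigFlatCells), `hs4` from p1's EXACT s₄ CHAIN at `d = 8 … 13` and its continuation at `d = 14 … 20`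
(`S1.ncard_fourCircuits_le_eighty_seven` … `…_one_thousand_five_hundred_twenty_one`, S1CoreCapEightExactFinal / …Chain / …ChainB — the cells
`8 ≤ d ≤ 20` carry the literal values) and from p1's T4⁺ `S1.ncard_fourCircuits_le_fourCircuitBound` (S1CoreFourCircuitSum) at `d ≥ 21`, and `hs5` from
`S1.fortyEight_mul_ncard_five_circuits_le_sharp` (S1FiveCircuitCountSharpC), the coranks `d ≥ 160` by the large-corank
inequality at `(37, n ≥ 197)` (`largeSeven_all37`) through `c025_core_seven_large_of_ineq` (RankLevelSetCoreSevenOfForm).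
* **`c025_core_seven_at_thirty_seven`** — the `e`-free core at rank `37`, every corank `d ≥ 8`;
* **`c025_seven_at_thirty_seven`** — level `7` at rank `37`, every finite matroid.
Axioms: standard.
-/

open scoped Matroid

namespace PercRepro

namespace ThmN

variable {α : Type}

/-- **The `e`-free core of level `7` at rank `37`, every corank `d ≥ 8`**: the numeric forms of the cells `(37, 8 … 159)` on
the telescoping count with the (C3)-refined triangle count, p1's exact s₄ chain (`d ≤ 20`) / T4⁺ (`d ≥ 21`), the averaging five-circuit count at `d = 8` and the sharp one elsewhere, the giant-flat case split at `d = 71 … 73`, the capped tail, and the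
large-corank inequality at `(37, n ≥ 197)`. -/
theorem c025_core_seven_at_thirty_seven (M : Matroid α) [M.Finite] (d : ℕ) (hd8 : 8 ≤ d) (hR : M.eRank = (37 : ℕ∞))
    (hn : M.E.ncard = 37 + d) (hfree : EFree M) : RLS M 37 7 := by
  rcases Nat.lt_or_ge d 160 with h | h
  · -- the circuit bounds: the re-based triangle count, T4⁺ and the sharp five-circuit count
    have hd : M.E.encard = M.eRank + d := by
      rw [hR, ← M.ground_finite.cast_ncard_eq, hn]
      push_cast
      ring
    have hs : ∀ e ∈ M.E, ∀ f ∈ M.E, e ≠ f → M.eRk {e, f} = 2 := by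
      intro e he f hf hef
      have h2 : (2 : ℕ∞) ≤ M.eRk {e, f} :=
        two_le_eRk_of_two_le_ncard_of_free M hfree (Set.pair_subset he hf) (by rw [Set.ncard_pair hef])
      have h3 : M.eRk {e, f} ≤ 2 := by
        have := M.eRk_le_encard {e, f}
        rwa [Set.encard_pair hef] at this
      exact le_antisymm h3 h2
    have hC1 : ∀ L ⊆ M.E, M.eRk L = 2 → L.ncard ≤ 3 :=
      fun L hL hr => ncard_le_three_of_eRk_two M hs hfree hL hr
    have hC2 : ∀ X ⊆ M.E, M.eRk X ≤ 3 → X.ncard ≤ 6 :=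
      fun X hX hr => ncard_le_six_of_eRk_le_three_of_free M hfree hX hr
    have hC3 : ∀ X ⊆ M.E, M.eRk X ≤ 4 → X.ncard ≤ 10 :=
      fun X hX hr => ncard_le_ten_of_eRk_le_four_of_free M hfree hX hr
    have hs3 : {C | M.IsCircuit C ∧ C.ncard = 3}.ncard ≤ S1.triBound8C d :=
      S1.ncard_triangles_le_triBound8C M hC1 hC2 hC3 hd
    have hs5 : {C | M.IsCircuit C ∧ C.ncard = 5}.ncard ≤ 7 * d * (d + 1) * (d * d + d + 10) / 48 := by
      have hT5 : 48 * {C : Set α | M.IsCircuit C ∧ C.ncard = 5}.ncard ≤ 7 * d * (d + 1) * (d * d + d + 10) :=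
        S1.fortyEight_mul_ncard_five_circuits_le_sharp M hC3 hd
      rw [Nat.le_div_iff_mul_le (by norm_num)]
      linarith [hT5]
    rcases Nat.lt_or_ge d 21 with h14 | h14
    · -- the coranks `8 … 20`: p1's exact s₄ chain / ChainB by name, the cells with the literal values
      interval_cases d
      · have hs3' : {C | M.IsCircuit C ∧ C.ncard = 3}.ncard ≤ 18 := by
          have h := hs3
          rwa [S1.triBound8C_val_8] at h
        have hs4 : {C | M.IsCircuit C ∧ C.ncard = 4}.ncard ≤ 87 :=
          S1.ncard_fourCircuits_le_eighty_seven M hfree hd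
        have hs5' : {C | M.IsCircuit C ∧ C.ncard = 5}.ncard ≤ 702 :=
          ncard_fiveCircuits_le_seven_oh_two M hfree hd
        exact c025_core_seven_of_form_splitky M 37 8 18 87 702 hd8 hR hn hfree hs3' hs4 hs5' (by norm_num) (by omega)
          tel_form37_8
      · have hs3' : {C | M.IsCircuit C ∧ C.ncard = 3}.ncard ≤ 22 := by
          have h := hs3
          rwa [S1.triBound8C_val_9] at h
        have hs4 : {C | M.IsCircuit C ∧ C.ncard = 4}.ncard ≤ 121 :=
          S1.ncard_fourCircuits_le_one_hundred_twenty_one M hfree hd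
        exact c025_core_seven_of_form_splitky M 37 9 22 121
          (7 * 9 * (9 + 1) * (9 * 9 + 9 + 10) / 48) hd8 hR hn hfree hs3' hs4 hs5 (by norm_num) (by omega)
          tel_form37_9
      · have hs3' : {C | M.IsCircuit C ∧ C.ncard = 3}.ncard ≤ 27 := by
          have h := hs3
          rwa [S1.triBound8C_val_10] at h
        have hs4 : {C | M.IsCircuit C ∧ C.ncard = 4}.ncard ≤ 165 :=
          S1.ncard_fourCircuits_le_one_hundred_sixty_five M hfree hd
        exact c025_core_seven_of_form_splitky M 37 10 27 165
          (7 * 10 * (10 + 1) * (10 * 10 + 10 + 10) / 48) hd8 hR hn hfree hs3' hs4 hs5 (by norm_num) (by omega)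
          tel_form37_10
      · have hs3' : {C | M.IsCircuit C ∧ C.ncard = 3}.ncard ≤ 33 := by
          have h := hs3
          rwa [S1.triBound8C_val_11] at h
        have hs4 : {C | M.IsCircuit C ∧ C.ncard = 4}.ncard ≤ 220 :=
          S1.ncard_fourCircuits_le_two_hundred_twenty M hfree hd
        exact c025_core_seven_of_form_splitky M 37 11 33 220
          (7 * 11 * (11 + 1) * (11 * 11 + 11 + 10) / 48) hd8 hR hn hfree hs3' hs4 hs5 (by norm_num) (by omega)
          tel_form37_11
      · have hs3' : {C | M.IsCircuit C ∧ C.ncard = 3}.ncard ≤ 40 := by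
          have h := hs3
          rwa [S1.triBound8C_val_12] at h
        have hs4 : {C | M.IsCircuit C ∧ C.ncard = 4}.ncard ≤ 287 :=
          S1.ncard_fourCircuits_le_two_hundred_eighty_seven M hfree hd
        exact c025_core_seven_of_form_splitky M 37 12 40 287
          (7 * 12 * (12 + 1) * (12 * 12 + 12 + 10) / 48) hd8 hR hn hfree hs3' hs4 hs5 (by norm_num) (by omega)
          tel_form37_12
      · have hs3' : {C | M.IsCircuit C ∧ C.ncard = 3}.ncard ≤ 48 := by
          have h := hs3
          rwa [S1.triBound8C_val_13] at h
        have hs4 : {C | M.IsCircuit C ∧ C.ncard = 4}.ncard ≤ 369 :=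
          S1.ncard_fourCircuits_le_three_hundred_sixty_nine M hfree hd
        exact c025_core_seven_of_form_splitky M 37 13 48 369
          (7 * 13 * (13 + 1) * (13 * 13 + 13 + 10) / 48) hd8 hR hn hfree hs3' hs4 hs5 (by norm_num) (by omega)
          tel_form37_13
      · have hs3' : {C | M.IsCircuit C ∧ C.ncard = 3}.ncard ≤ 57 := by
          have h := hs3
          rwa [S1.triBound8C_val_14] at h
        have hs4 : {C | M.IsCircuit C ∧ C.ncard = 4}.ncard ≤ 467 :=
          S1.ncard_fourCircuits_le_four_hundred_sixty_seven M hfree hd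
        exact c025_core_seven_of_form_splitky M 37 14 57 467
          (7 * 14 * (14 + 1) * (14 * 14 + 14 + 10) / 48) hd8 hR hn hfree hs3' hs4 hs5 (by norm_num) (by omega)
          tel_form37_14
      · have hs3' : {C | M.IsCircuit C ∧ C.ncard = 3}.ncard ≤ 66 := by
          have h := hs3
          rwa [S1.triBound8C_val_15] at h
        have hs4 : {C | M.IsCircuit C ∧ C.ncard = 4}.ncard ≤ 583 :=
          S1.ncard_fourCircuits_le_five_hundred_eighty_three M hfree hd
        exact c025_core_seven_of_form_splitky M 37 15 66 583
          (7 * 15 * (15 + 1) * (15 * 15 + 15 + 10) / 48) hd8 hR hn hfree hs3' hs4 hs5 (by norm_num) (by omega)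
          tel_form37_15
      · have hs3' : {C | M.IsCircuit C ∧ C.ncard = 3}.ncard ≤ 76 := by
          have h := hs3
          rwa [S1.triBound8C_val_16] at h
        have hs4 : {C | M.IsCircuit C ∧ C.ncard = 4}.ncard ≤ 720 :=
          S1.ncard_fourCircuits_le_seven_hundred_twenty M hfree hd
        exact c025_core_seven_of_form_splitky M 37 16 76 720
          (7 * 16 * (16 + 1) * (16 * 16 + 16 + 10) / 48) hd8 hR hn hfree hs3' hs4 hs5 (by norm_num) (by omega)
          tel_form37_16
      · have hs3' : {C | M.IsCircuit C ∧ C.ncard = 3}.ncard ≤ 87 := by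
          have h := hs3
          rwa [S1.triBound8C_val_17] at h
        have hs4 : {C | M.IsCircuit C ∧ C.ncard = 4}.ncard ≤ 880 :=
          S1.ncard_fourCircuits_le_eight_hundred_eighty M hfree hd
        exact c025_core_seven_of_form_splitky M 37 17 87 880
          (7 * 17 * (17 + 1) * (17 * 17 + 17 + 10) / 48) hd8 hR hn hfree hs3' hs4 hs5 (by norm_num) (by omega)
          tel_form37_17
      · have hs3' : {C | M.IsCircuit C ∧ C.ncard = 3}.ncard ≤ 98 := by
          have h := hs3
          rwa [S1.triBound8C_val_18] at h
        have hs4 : {C | M.IsCircuit C ∧ C.ncard = 4}.ncard ≤ 1065 :=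
          S1.ncard_fourCircuits_le_one_thousand_sixty_five M hfree hd
        exact c025_core_seven_of_form_splitky M 37 18 98 1065
          (7 * 18 * (18 + 1) * (18 * 18 + 18 + 10) / 48) hd8 hR hn hfree hs3' hs4 hs5 (by norm_num) (by omega)
          tel_form37_18
      · have hs3' : {C | M.IsCircuit C ∧ C.ncard = 3}.ncard ≤ 110 := by
          have h := hs3
          rwa [S1.triBound8C_val_19] at h
        have hs4 : {C | M.IsCircuit C ∧ C.ncard = 4}.ncard ≤ 1278 :=
          S1.ncard_fourCircuits_le_one_thousand_two_hundred_seventy_eight M hfree hd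
        exact c025_core_seven_of_form_splitky M 37 19 110 1278
          (7 * 19 * (19 + 1) * (19 * 19 + 19 + 10) / 48) hd8 hR hn hfree hs3' hs4 hs5 (by norm_num) (by omega)
          tel_form37_19
      · have hs3' : {C | M.IsCircuit C ∧ C.ncard = 3}.ncard ≤ 123 := by
          have h := hs3
          rwa [S1.triBound8C_val_20] at h
        have hs4 : {C | M.IsCircuit C ∧ C.ncard = 4}.ncard ≤ 1521 :=
          S1.ncard_fourCircuits_le_one_thousand_five_hundred_twenty_one M hfree hd
        exact c025_core_seven_of_form_splitky M 37 20 123 1521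
          (7 * 20 * (20 + 1) * (20 * 20 + 20 + 10) / 48) hd8 hR hn hfree hs3' hs4 hs5 (by norm_num) (by omega)
          tel_form37_20
    · -- the coranks `21 … 70`: T4⁺ in the S4 slot, the dispatcher `tel_form37_lo`
      rcases Nat.lt_or_ge d 71 with h70 | h70
      · have hs4 : {C | M.IsCircuit C ∧ C.ncard = 4}.ncard ≤ S1.fourCircuitBound d :=
          S1.ncard_fourCircuits_le_fourCircuitBound M hfree hd
        exact c025_core_seven_of_form_splitky M 37 d (S1.triBound8C d) (S1.fourCircuitBound d)
          (7 * d * (d + 1) * (d * d + d + 10) / 48) hd8 hR hn hfree hs3 hs4 hs5 (by norm_num) (by omega)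
          (tel_form37_lo d h14 (by omega))
      rcases Nat.lt_or_ge d 74 with h73 | h73
      · -- the coranks `71 … 73`: the giant-flat case split (RankLevelSetLevelSevenRowThirtySevenBigFlatCells)
        interval_cases d
        · have hs3' : {C | M.IsCircuit C ∧ C.ncard = 3}.ncard ≤ 1759 := by
            have h := hs3
            rwa [S1.triBound8C_val_71] at h
          have hs4' : {C | M.IsCircuit C ∧ C.ncard = 4}.ncard ≤ 92646 := by
            have h := S1.ncard_fourCircuits_le_fourCircuitBound M hfree hd
            rwa [show S1.fourCircuitBound 71 = 92646 by norm_num [S1.fourCircuitBound_eq]] at h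
          have hs5' : {C | M.IsCircuit C ∧ C.ncard = 5}.ncard ≤ 3818451 := by
            have h := hs5
            norm_num at h
            exact h
          exact c025_core_seven_cell_thirty_seven_seventy_one M hR hn hfree hs3' hs4' hs5'
        · have hs3' : {C | M.IsCircuit C ∧ C.ncard = 3}.ncard ≤ 1810 := by
            have h := hs3
            rwa [S1.triBound8C_val_72] at h
          have hs4' : {C | M.IsCircuit C ∧ C.ncard = 4}.ncard ≤ 96570 := by
            have h := S1.ncard_fourCircuits_le_fourCircuitBound M hfree hd
            rwa [show S1.fourCircuitBound 72 = 96570 by norm_num [S1.fourCircuitBound_eq]] at h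
          have hs5' : {C | M.IsCircuit C ∧ C.ncard = 5}.ncard ≤ 4036389 := by
            have h := hs5
            norm_num at h
            exact h
          exact c025_core_seven_cell_thirty_seven_seventy_two M hR hn hfree hs3' hs4' hs5'
        · have hs3' : {C | M.IsCircuit C ∧ C.ncard = 3}.ncard ≤ 1862 := by
            have h := hs3
            rwa [S1.triBound8C_val_73] at h
          have hs4' : {C | M.IsCircuit C ∧ C.ncard = 4}.ncard ≤ 100603 := by
            have h := S1.ncard_fourCircuits_le_fourCircuitBound M hfree hd
            rwa [show S1.fourCircuitBound 73 = 100603 by norm_num [S1.fourCircuitBound_eq]] at h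
          have hs5' : {C | M.IsCircuit C ∧ C.ncard = 5}.ncard ≤ 4263528 := by
            have h := hs5
            norm_num at h
            exact h
          exact c025_core_seven_cell_thirty_seven_seventy_three M hR hn hfree hs3' hs4' hs5'
      · -- the coranks `74 … 159`: T4⁺ in the S4 slot, the dispatcher `tel_form37_hi`
        have hs4 : {C | M.IsCircuit C ∧ C.ncard = 4}.ncard ≤ S1.fourCircuitBound d :=
          S1.ncard_fourCircuits_le_fourCircuitBound M hfree hd
        exact c025_core_seven_of_form_splitky M 37 d (S1.triBound8C d) (S1.fourCircuitBound d)
          (7 * d * (d + 1) * (d * d + d + 10) / 48) hd8 hR hn hfree hs3 hs4 hs5 (by norm_num) (by omega)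
          (tel_form37_hi d h73 (by omega))
  · exact c025_core_seven_large_of_ineq M 37 hR (largeSeven_all37 M.E.ncard (by omega)) hfree

/-- **Level `7` at rank `37`, every finite matroid**: `rls_succ_large_at 6 7 37` on level `6` at `36` (`c025_six_all`), the
coranks `≤ 7` (`U = ∅` or Theorem M) and the core at `37`. -/
theorem c025_seven_at_thirty_seven (M : Matroid α) [M.Finite] : RLS M 37 7 := by
  refine rls_succ_large_at (α := α) 6 7 37 (by norm_num) (fun M _ => c025_six_all M 36 (by norm_num)) ?_ ?_ M
  · -- corank `≤ 7`: `U = ∅` or Theorem M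
    intro M _ hn
    rcases Nat.lt_or_ge M.E.ncard (37 + 7) with h | h
    · exact RLS_of_ncard_lt M h
    · exact RLS_of_ncard_eq M (by omega)
  · -- the core at corank `≥ 8`
    intro M _ hR hbig hfree
    exact c025_core_seven_at_thirty_seven M (M.E.ncard - 37) (by omega) hR (by omega) hfree

end ThmN

end PercRepro
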